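import Summits.QuantumFields.YangMills.Theorems.LatticeGapOnTrajectory.Negative.ZeroCoupling

/-!
# `LatticeGapOnTrajectory` — negative-side support II: the lattice half at zero coupling; junk reach of the gap clauses

Second support file for crux `stmt-QuantumFields-10523` (`ParabolicTrajectory.LatticeGapOnTrajectory`, (B)),
extracted from the standing disprover's work file `Cruxes/LatticeGapOnTrajectory/Disproof.lean` §4c; builds on
`Negative/ZeroCoupling.lean` (p69462). Tree objects only, nothing posited.

* `disjoint_torusSupports_of_time_bound`: supports of time-extent `R` and their translate by `n e₀` share no torus
  link when `2R < n` and `n + 2R < S` (a `ZMod S` computation).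
* `abs_integral_mul_le_zero_coupling`: `|⟨f g⟩_{β=0}| ≤ C_f C_g` for bounded `f, g` (product Haar is a probability).
* `hasLatticeMassGap_of_zero_coupling`: for a scheme with `β_k = 0` for all `k`, `HasLatticeMassGap r sch Δ` holds
  for EVERY `Δ` (the docstring claim of `HasLatticeMassGap` in `YangMillsOS.lean`, now proved).
* `gap_clauses_junk_reachable`: the zero scheme and the vacuum-only OS datum satisfy
  `IsYangMillsFor r sch T ∧ ∀ Δ, T.HasMassGap Δ ∧ HasLatticeMassGap r sch Δ` — every clause of `YangMills` except
  `IsNontrivial`/`IsNonGaussian` is reachable by junk; for the crux, the shape of (B)'s conclusion is contentless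
  and all of its strength sits in the tuned, `β_k → ∞` hypotheses.
-/

namespace Summit.QuantumFields.YangMills.Theorems.LatticeGapOnTrajectory.Negative

open Filter Topology MeasureTheory ProbabilityTheory
open Literature.MathematicalPhysics.QuantumFieldTheory Literature.MathematicalPhysics.QuantumLattice

noncomputable section

section ZeroCouplingGap

variable {G : Type} [Group G] [TopologicalSpace G] [IsTopologicalGroup G] [CompactSpace G]
  [MeasurableSpace G] [BorelSpace G]

omit [Group G] [TopologicalSpace G] [IsTopologicalGroup G] [CompactSpace G] [MeasurableSpace G] [BorelSpace G] in
/-- General no-overlap lemma: if every edge of `SA` and `SB` has time coordinate in `[-R, R]`, then for separations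
`2R < n` with `n + 2R < S` the torus projections of `SA` and of `SB + n e₀` are disjoint. [folklore] -/
theorem disjoint_torusSupports_of_time_bound (SA SB : Finset (Literature.MathematicalPhysics.QuantumLattice.ZdEdge 4))
    (R : ℕ) (hA : ∀ e ∈ SA, |e.1 0| ≤ R) (hB : ∀ e ∈ SB, |e.1 0| ≤ R) {S n : ℕ} (hn : 2 * R < n)
    (hnS : n + 2 * R < S) :
    Disjoint (SA.image (torusEdge S))
      ((SB.image fun e : Literature.MathematicalPhysics.QuantumLattice.ZdEdge 4 =>
        (e.1 - -(Pi.single 0 (n : ℤ) : Literature.Probability.LatticeModels.Site 4), e.2)).image (torusEdge S)) := by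
  rw [Finset.disjoint_left]
  rintro a ha hb
  rw [Finset.mem_image] at ha
  obtain ⟨e₁, he₁, rfl⟩ := ha
  simp only [Finset.mem_image] at hb
  obtain ⟨e₂', ⟨e₂, he₂, rfl⟩, heq⟩ := hb
  have h1 := abs_le.1 (hA e₁ he₁)
  have h2 := abs_le.1 (hB e₂ he₂)
  have h0 : (((e₂.1 0 + (n : ℤ) : ℤ)) : ZMod S) = ((e₁.1 0 : ℤ) : ZMod S) := by
    have := congrArg (fun E : Edge 4 S => E.1 0) heq
    simpa [torusEdge, Literature.Probability.LatticeModels.Torus.proj] using this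
  rw [ZMod.intCast_eq_intCast_iff_dvd_sub] at h0
  have hdvd : (S : ℤ) ∣ (e₂.1 0 + n) - e₁.1 0 := dvd_sub_comm.1 h0
  have hpos : (0 : ℤ) < (e₂.1 0 + n) - e₁.1 0 := by omega
  have hle := Int.le_of_dvd hpos hdvd
  omega

/-- At zero coupling every lattice expectation of a product of two bounded observables is bounded by the product of
the bounds (probability measure). [folklore] -/
theorem abs_integral_mul_le_zero_coupling {N : ℕ} (ρ : G →* Matrix (Fin N) (Fin N) ℂ) (S : ℕ) [NeZero S]
    {f g : GaugeConfig 4 S G → ℝ} {Cf Cg : ℝ} (hf : ∀ U, |f U| ≤ Cf) (hg : ∀ U, |g U| ≤ Cg) :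
    |∫ U, f U * g U ∂(wilsonMeasure (d := 4) (L := S) ρ 0)| ≤ Cf * Cg := by
  rw [wilsonMeasure_zero_coupling ρ S]
  have h : ∀ U : GaugeConfig 4 S G, ‖f U * g U‖ ≤ Cf * Cg := fun U => by
    rw [Real.norm_eq_abs, abs_mul]
    exact mul_le_mul (hf U) (hg U) (abs_nonneg _) ((abs_nonneg _).trans (hf U))
  have := norm_integral_le_of_norm_le_const (μ := Measure.pi fun _ : Edge 4 S => haarProbability G)
    (Eventually.of_forall h)
  simpa using this

/-- **The lattice half holds with EVERY rate at zero coupling.** For a scheme with `β_k = 0` for all `k`, the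
uniform lattice mass gap `HasLatticeMassGap r sch Δ` holds for every `Δ` (infinite gap: beyond the time-extent of
the supports the connected correlations vanish identically, below it they are bounded). So the lattice half of
(B)'s conclusion does not detect triviality — which is why the summit statement carries `IsNontrivial` — and a
disprover cannot attack it through any ultralocal mechanism. (Tree docstring of `HasLatticeMassGap` asserts this
without proof; here it is a theorem.) [folklore] -/
theorem hasLatticeMassGap_of_zero_coupling {ι : Type} (r : LatticeRep G) (sch : SpeciesScheme ι)
    (hβ : ∀ k, sch.β k = 0) (Δ : ℝ) : HasLatticeMassGap r sch Δ := by
  intro A B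
  obtain ⟨CA, hCA⟩ := A.bounded
  obtain ⟨CB, hCB⟩ := B.bounded
  -- time extent of the two supports
  set R : ℕ := (A.supp ∪ B.supp).sup fun e => (e.1 0).natAbs with hR
  have hRA : ∀ e ∈ A.supp, |e.1 0| ≤ R := fun e he => by
    have : (e.1 0).natAbs ≤ R := Finset.le_sup (f := fun e => (e.1 0).natAbs) (Finset.mem_union_left _ he)
    rw [Int.abs_eq_natAbs]; exact_mod_cast this
  have hRB : ∀ e ∈ B.supp, |e.1 0| ≤ R := fun e he => by
    have : (e.1 0).natAbs ≤ R := Finset.le_sup (f := fun e => (e.1 0).natAbs) (Finset.mem_union_right _ he)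
    rw [Int.abs_eq_natAbs]; exact_mod_cast this
  refine ⟨2 * (CA * CB) * Real.exp (|Δ| * (2 * R)), ?_⟩
  have ha1 : ∀ᶠ k in atTop, sch.a k ≤ 1 :=
    (sch.tendsto_a.eventually (gt_mem_nhds one_pos)).mono fun k hk => hk.le
  have hL : ∀ᶠ k in atTop, (2 * R + 1 : ℝ) ≤ sch.a k * sch.L k := sch.tendsto_L.eventually_ge_atTop _
  filter_upwards [ha1, hL] with k hk1 hkL S hS n hn
  have hCAB : 0 ≤ CA * CB := mul_nonneg ((abs_nonneg _).trans (hCA 1)) ((abs_nonneg _).trans (hCB 1))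
  -- L_k ≥ 2R + 1 (as naturals)
  have hLk : 2 * R + 1 ≤ sch.L k := by
    have h1 : (2 * R + 1 : ℝ) ≤ sch.L k := by
      refine hkL.trans ?_
      calc sch.a k * sch.L k ≤ 1 * sch.L k :=
            mul_le_mul_of_nonneg_right hk1 (Nat.cast_nonneg _)
        _ = sch.L k := one_mul _
    exact_mod_cast h1
  rw [hβ k]
  by_cases hsmall : n ≤ 2 * R
  · -- bounded regime: |corr| ≤ 2 CA CB ≤ C e^{-Δ a n}
    have hcorr : |latticeConnectedCorr r.ρ 0 (2 * S + 1) A.F B.F n| ≤ 2 * (CA * CB) := by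
      unfold latticeConnectedCorr
      refine (abs_sub _ _).trans ?_
      have h1 := abs_integral_mul_le_zero_coupling r.ρ (2 * S + 1)
        (f := fun U => A.F (torusLift (2 * S + 1) U))
        (g := fun U => B.F (configShift (-Pi.single 0 (n : ℤ)) (torusLift (2 * S + 1) U)))
        (fun U => hCA _) (fun U => hCB _)
      have h2 : |(∫ U, A.F (torusLift (2 * S + 1) U) ∂(wilsonMeasure (d := 4) (L := 2 * S + 1) r.ρ 0)) *
          ∫ U, B.F (torusLift (2 * S + 1) U) ∂(wilsonMeasure (d := 4) (L := 2 * S + 1) r.ρ 0)| ≤ CA * CB := by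
        rw [abs_mul]
        have hA1 := abs_integral_mul_le_zero_coupling r.ρ (2 * S + 1)
          (f := fun U => A.F (torusLift (2 * S + 1) U)) (g := fun _ => (1 : ℝ)) (Cg := 1)
          (fun U => hCA _) (fun U => by simp)
        have hB1 := abs_integral_mul_le_zero_coupling r.ρ (2 * S + 1)
          (f := fun U => B.F (torusLift (2 * S + 1) U)) (g := fun _ => (1 : ℝ)) (Cg := 1)
          (fun U => hCB _) (fun U => by simp)
        simp only [mul_one] at hA1 hB1
        exact mul_le_mul hA1 hB1 (abs_nonneg _) ((abs_nonneg _).trans hA1)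
      linarith
    refine hcorr.trans ?_
    have hexp : Real.exp (-(|Δ| * (2 * R))) ≤ Real.exp (-(Δ * (sch.a k * n))) := by
      apply Real.exp_le_exp.2
      have hn' : (n : ℝ) ≤ 2 * R := by exact_mod_cast hsmall
      have han : 0 ≤ sch.a k * n := mul_nonneg (sch.a_pos k).le (Nat.cast_nonneg _)
      have : Δ * (sch.a k * n) ≤ |Δ| * (2 * R) := by
        calc Δ * (sch.a k * n) ≤ |Δ| * (sch.a k * n) := mul_le_mul_of_nonneg_right (le_abs_self Δ) han
          _ ≤ |Δ| * (1 * (2 * R)) := by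
              apply mul_le_mul_of_nonneg_left _ (abs_nonneg Δ)
              exact mul_le_mul hk1 hn' (Nat.cast_nonneg _) zero_le_one
          _ = |Δ| * (2 * R) := by ring
      linarith
    calc 2 * (CA * CB) = 2 * (CA * CB) * Real.exp (|Δ| * (2 * R)) * Real.exp (-(|Δ| * (2 * R))) := by
          rw [mul_assoc, ← Real.exp_add, add_neg_cancel, Real.exp_zero, mul_one]
      _ ≤ 2 * (CA * CB) * Real.exp (|Δ| * (2 * R)) * Real.exp (-(Δ * (sch.a k * n))) :=
          mul_le_mul_of_nonneg_left hexp (by positivity)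
  · -- ultralocal regime: the correlation vanishes identically
    push Not at hsmall
    have hzero : latticeConnectedCorr r.ρ 0 (2 * S + 1) A.F B.F n = 0 :=
      latticeConnectedCorr_zero_coupling r.ρ (2 * S + 1) A B n
        (disjoint_torusSupports_of_time_bound A.supp B.supp R hRA hRB hsmall (by omega))
    rw [hzero, abs_zero]
    positivity

/-- **The gap clauses of the summit are junk-reachable.** For every gauge group with a lattice representation,
the degenerate scheme (`β ≡ 0`, `c = m = 0`) and the vacuum-only OS datum satisfy `IsYangMillsFor` together with
`T.HasMassGap Δ ∧ HasLatticeMassGap r sch Δ` for EVERY `Δ`: everything in `YangMills` except the clauses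
`IsNontrivial`/`IsNonGaussian` is reachable by junk. For the crux: the SHAPE of (B)'s conclusion carries no
content by itself — all of (B)'s strength sits in its hypotheses selecting interacting (tuned, `β_k → ∞`)
sequences, consistent with §3. [folklore] -/
theorem gap_clauses_junk_reachable (r : LatticeRep G) :
    ∃ (sch : SpeciesScheme (YMSpecies G)) (T : OSData (YMSpecies G) 4),
      IsYangMillsFor r sch T ∧ ∀ Δ : ℝ, T.HasMassGap Δ ∧ HasLatticeMassGap r sch Δ :=
  ⟨SpeciesScheme.zero _, OSData.vacuum _ 4, isYangMillsFor_vacuum r,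
    fun Δ => ⟨OSData.vacuum_hasMassGap Δ, hasLatticeMassGap_of_zero_coupling r _ (fun _ => rfl) Δ⟩⟩

end ZeroCouplingGap

end

end Summit.QuantumFields.YangMills.Theorems.LatticeGapOnTrajectory.Negative
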